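import Literature.AlgebraicGeometry.RealAlgebraic.RealAbelJacobi
import Mathlib.Analysis.InnerProductSpace.PiL2
import Mathlib.Analysis.InnerProductSpace.Projection.Basic
import Mathlib.Analysis.Calculus.ContDiff.FiniteDimension
import Mathlib.LinearAlgebra.Matrix.NonsingularInverse
import Mathlib.LinearAlgebra.Matrix.ToLinearEquiv
import Mathlib.LinearAlgebra.Matrix.DotProduct
import Mathlib.Geometry.Manifold.PartitionOfUnity
import HarnessLib

/-!
# Tangent spaces of embedded submanifolds of `ℝⁿ` and the orthogonal projection onto them

Elementary differential geometry of the embedded-submanifold predicate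
`Literature.AlgebraicGeometry.RealAlgebraic.IsSubmanifoldOfDim d S` of
`RealAlgebraic/RealAbelJacobi` (`S ⊆ ℝⁿ` is near each of its points the image of the unit ball of
`ℝᵈ` under a `C^∞` map `φ` with a `C^∞` left inverse `ψ` defined on an open set `U`):

* `SubmanifoldChart d S` — the chart data `(U, φ, ψ)` as a structure, with its calculus
  (`φ ∘ ψ = id` on `S ∩ U`, `Dψ ∘ Dφ = id`, `Dφ` injective);
* **the tangent space** `tangentSpace S x` (the span of the kinematic tangent vectors
  `tangentVelocities S x` of `RealAbelJacobi`): at a point of a `d`-dimensional submanifold it is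
  the `d`-dimensional subspace `range Dφ(ψ x)`, it *equals* the set of tangent velocities
  (`coe_tangentSpace`), and it equals the **secant cone** `secantCone S x` — the first-order
  definable set of directions `v` such that `S` contains points `y` with `y - x = t v + O(ε t)`,
  `0 < t < ε`, for every `ε > 0` (`secantCone_eq_tangentSpace`; this is what makes tangent spaces of
  semialgebraic submanifolds semialgebraic, file `RealAlgebraic/SemialgebraicTangent`);
* **the orthogonal projection** `orthProj K` onto a subspace `K ⊆ ℝⁿ` for the dot product
  (transported from Mathlib's `Submodule.starProjection` on `EuclideanSpace ℝ (Fin n)`), its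
  characterisation by `orthProj K v ∈ K`, `(v - orthProj K v) ⬝ᵥ w = 0` for `w ∈ K`
  (`orthProj_eq_of_mem_of_dotProduct_eq_zero`);
* **smoothness of the tangent projection field**: for a closed `C^∞` submanifold `S` there is a
  `C^∞` map `P : ℝⁿ → L(ℝⁿ, ℝⁿ)` with `P x = orthProj (tangentSpace S x)` for all `x ∈ S`
  (`IsSubmanifoldOfDim.exists_contDiff_orthProj`): locally `P = B (BᵀB)⁻¹ Bᵀ` with
  `B(y) = Dφ(ψ y)` (Gram inverse, smooth by Cramer's rule), glued along the closed set `S` by a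
  partition of unity (`exists_contDiff_of_local`, Lee, *Introduction to Smooth Manifolds*,
  Lemma 2.26).

These are the differential-geometric inputs for the invariant coframe of the real points of an
abelian variety (`RealAbelJacobi.exists_realization`): the forms are
`ωᵢ(x) = ℓᵢ ∘ D(y ↦ (−x) + y)(x) ∘ P(x)`. Standard material (Lee, Ch. 3 and Prop. 5.16 ff.;
Bochnak–Coste–Roy §3.3 for the Nash setting); no named fact is introduced.

## References

* J. M. Lee, *Introduction to Smooth Manifolds*, 2nd ed. (2013), Lemma 2.26, Prop. 3.23,
  Thm. 5.8, Prop. 5.16, Prop. 5.38. [LeeSmoothManifolds2013]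
* J. Bochnak, M. Coste, M.-F. Roy, *Real Algebraic Geometry* (1998), §3.3, Prop. 3.3.11.
  [BochnakCosteRoy1998]
-/

noncomputable section

open Set Filter Asymptotics Metric Function
open scoped ContDiff Topology Matrix

namespace Literature.AlgebraicGeometry.RealAlgebraic

/-! ### Gluing local smooth representatives along a closed set -/

/-- **Extension lemma for smooth functions on closed sets** (Lee, Lemma 2.26, in the form needed
here): let `S` be a closed subset of a finite-dimensional real normed space `E` and `T : E → F` a
function which, near every point of `S`, agrees *on `S`* with a function `C^∞` on a neighbourhood.
Then some `C^∞` function `G : E → F` agrees with `T` on `S`. (Smooth partition of unity subordinate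
to the local domains together with `Sᶜ`; Mathlib
`exists_contMDiffMap_forall_mem_convex_of_local` with the convex constraint `{T x}` on `S`.)
[cite: LeeSmoothManifolds2013, Lemma 2.26] -/
theorem exists_contDiff_of_local {E F : Type*} [NormedAddCommGroup E] [NormedSpace ℝ E]
    [FiniteDimensional ℝ E] [NormedAddCommGroup F] [NormedSpace ℝ F] {S : Set E}
    (hS : IsClosed S) (T : E → F)
    (hloc : ∀ x ∈ S, ∃ U ∈ 𝓝 x, ∃ G : E → F, ContDiffOn ℝ ∞ G U ∧ ∀ y ∈ S ∩ U, G y = T y) :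
    ∃ G : E → F, ContDiff ℝ ∞ G ∧ ∀ x ∈ S, G x = T x := by
  classical
  let t : E → Set F := fun x => if x ∈ S then {T x} else univ
  have ht : ∀ x, Convex ℝ (t x) := fun x => by
    by_cases hx : x ∈ S
    · simp only [t, if_pos hx]
      exact convex_singleton _
    · simp only [t, if_neg hx]
      exact convex_univ
  have Hloc : ∀ x : E, ∃ U ∈ 𝓝 x, ∃ g : E → F,
      ContMDiffOn (modelWithCornersSelf ℝ E) (modelWithCornersSelf ℝ F) ∞ g U ∧
        ∀ y ∈ U, g y ∈ t y := by
    intro x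
    by_cases hx : x ∈ S
    · obtain ⟨U, hU, G, hG, hGT⟩ := hloc x hx
      refine ⟨U, hU, G, contMDiffOn_iff_contDiffOn.mpr hG, fun y hy => ?_⟩
      by_cases hy' : y ∈ S
      · simp only [t, if_pos hy']
        exact mem_singleton_iff.mpr (hGT y ⟨hy', hy⟩)
      · simp only [t, if_neg hy']
        exact mem_univ _
    · refine ⟨Sᶜ, hS.isOpen_compl.mem_nhds hx, fun _ => 0, contMDiffOn_const, fun y hy => ?_⟩
      simp only [t, if_neg (show y ∉ S from hy)]
      exact mem_univ _
  obtain ⟨g, hg⟩ :=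
    exists_contMDiffMap_forall_mem_convex_of_local (modelWithCornersSelf ℝ E) ht Hloc
  refine ⟨g, contMDiff_iff_contDiff.mp g.contMDiff, fun x hx => ?_⟩
  have h := hg x
  simp only [t, if_pos hx, mem_singleton_iff] at h
  exact h

/-! ### Charts of an embedded submanifold and their calculus -/

variable {n d : ℕ}

/-- **A chart of the embedded submanifold `S ⊆ ℝⁿ`** in the sense of `IsSubmanifoldOfDim d S`: an
open `U ⊆ ℝⁿ`, a map `φ : ℝᵈ → ℝⁿ` which is `C^∞` on the open unit ball `B` and a map
`ψ : ℝⁿ → ℝᵈ` which is `C^∞` on `U`, with `ψ ∘ φ = id` on `B` and `φ(B) = S ∩ U`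
(Lee, Thm. 5.8 / Prop. 5.16: local slice charts). [cite: LeeSmoothManifolds2013, Thm. 5.8] -/
structure SubmanifoldChart (d : ℕ) (S : Set (Fin n → ℝ)) where
  /-- The chart domain in `ℝⁿ`. -/
  U : Set (Fin n → ℝ)
  /-- The local parametrisation `B → S ∩ U`. -/
  φ : (Fin d → ℝ) → (Fin n → ℝ)
  /-- The left inverse of `φ`, defined (and smooth) on `U`. -/
  ψ : (Fin n → ℝ) → (Fin d → ℝ)
  isOpen_U : IsOpen U
  contDiffOn_φ : ContDiffOn ℝ ∞ φ (ball 0 1)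
  contDiffOn_ψ : ContDiffOn ℝ ∞ ψ U
  ψ_φ : ∀ t ∈ ball (0 : Fin d → ℝ) 1, ψ (φ t) = t
  image_eq : φ '' ball 0 1 = S ∩ U

/-- Every point of a `d`-dimensional submanifold lies in the domain of a chart. [folklore] -/
theorem IsSubmanifoldOfDim.exists_chart {S : Set (Fin n → ℝ)} (hS : IsSubmanifoldOfDim d S)
    {x : Fin n → ℝ} (hx : x ∈ S) : ∃ c : SubmanifoldChart d S, x ∈ c.U := by
  obtain ⟨U, φ, ψ, hU, hxU, hφ, hψ, hψφ, himg⟩ := hS x hx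
  exact ⟨⟨U, φ, ψ, hU, hφ, hψ, hψφ, himg⟩, hxU⟩

namespace SubmanifoldChart

variable {S : Set (Fin n → ℝ)} (c : SubmanifoldChart d S)

/-- Points of the ball parametrise points of `S ∩ U`. [folklore] -/
theorem φ_mem {t : Fin d → ℝ} (ht : t ∈ ball (0 : Fin d → ℝ) 1) : c.φ t ∈ S ∩ c.U :=
  c.image_eq ▸ mem_image_of_mem _ ht

/-- `ψ` maps `S ∩ U` into the ball. [folklore] -/
theorem ψ_mem_ball {y : Fin n → ℝ} (hy : y ∈ S ∩ c.U) : c.ψ y ∈ ball (0 : Fin d → ℝ) 1 := by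
  rw [← c.image_eq] at hy
  obtain ⟨t, ht, rfl⟩ := hy
  rw [c.ψ_φ t ht]
  exact ht

/-- `φ ∘ ψ = id` on `S ∩ U`. [folklore] -/
theorem φ_ψ {y : Fin n → ℝ} (hy : y ∈ S ∩ c.U) : c.φ (c.ψ y) = y := by
  rw [← c.image_eq] at hy
  obtain ⟨t, ht, rfl⟩ := hy
  rw [c.ψ_φ t ht]

/-- `φ` is `C^∞` at points of the ball. [folklore] -/
theorem contDiffAt_φ {t : Fin d → ℝ} (ht : t ∈ ball (0 : Fin d → ℝ) 1) :
    ContDiffAt ℝ ∞ c.φ t :=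
  c.contDiffOn_φ.contDiffAt (isOpen_ball.mem_nhds ht)

/-- `ψ` is `C^∞` at points of `U`. [folklore] -/
theorem contDiffAt_ψ {y : Fin n → ℝ} (hy : y ∈ c.U) : ContDiffAt ℝ ∞ c.ψ y :=
  c.contDiffOn_ψ.contDiffAt (c.isOpen_U.mem_nhds hy)

/-- `φ` is differentiable at points of the ball. [folklore] -/
theorem hasFDerivAt_φ {t : Fin d → ℝ} (ht : t ∈ ball (0 : Fin d → ℝ) 1) :
    HasFDerivAt c.φ (fderiv ℝ c.φ t) t :=
  ((c.contDiffAt_φ ht).differentiableAt (by simp)).hasFDerivAt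

/-- `ψ` is differentiable at points of `U`. [folklore] -/
theorem hasFDerivAt_ψ {y : Fin n → ℝ} (hy : y ∈ c.U) :
    HasFDerivAt c.ψ (fderiv ℝ c.ψ y) y :=
  ((c.contDiffAt_ψ hy).differentiableAt (by simp)).hasFDerivAt

/-- **`Dψ(φ t) ∘ Dφ(t) = id`** (chain rule on `ψ ∘ φ = id` near `t`). [folklore] -/
theorem fderiv_ψ_comp_fderiv_φ {t : Fin d → ℝ} (ht : t ∈ ball (0 : Fin d → ℝ) 1) :
    (fderiv ℝ c.ψ (c.φ t)).comp (fderiv ℝ c.φ t) = ContinuousLinearMap.id ℝ (Fin d → ℝ) := by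
  have h1 : HasFDerivAt (c.ψ ∘ c.φ) ((fderiv ℝ c.ψ (c.φ t)).comp (fderiv ℝ c.φ t)) t :=
    (c.hasFDerivAt_ψ (c.φ_mem ht).2).comp t (c.hasFDerivAt_φ ht)
  have h2 : HasFDerivAt (c.ψ ∘ c.φ) (ContinuousLinearMap.id ℝ (Fin d → ℝ)) t := by
    refine (hasFDerivAt_id t).congr_of_eventuallyEq ?_
    filter_upwards [isOpen_ball.mem_nhds ht] with s hs
    exact c.ψ_φ s hs
  exact h1.unique h2

/-- `Dψ(φ t) (Dφ(t) u) = u`. [folklore] -/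
theorem fderiv_ψ_fderiv_φ {t : Fin d → ℝ} (ht : t ∈ ball (0 : Fin d → ℝ) 1) (u : Fin d → ℝ) :
    fderiv ℝ c.ψ (c.φ t) (fderiv ℝ c.φ t u) = u := by
  have h := congrArg (fun L : (Fin d → ℝ) →L[ℝ] (Fin d → ℝ) => L u) (c.fderiv_ψ_comp_fderiv_φ ht)
  simpa using h

/-- **`Dφ(t)` is injective** (it has the left inverse `Dψ(φ t)`). [folklore] -/
theorem injective_fderiv_φ {t : Fin d → ℝ} (ht : t ∈ ball (0 : Fin d → ℝ) 1) :
    Injective (fderiv ℝ c.φ t) := fun u₁ u₂ h => by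
  rw [← c.fderiv_ψ_fderiv_φ ht u₁, ← c.fderiv_ψ_fderiv_φ ht u₂, h]

/-! ### Tangent velocities in a chart -/

/-- **Tangent velocities are the image of `Dφ`** (`⊇`): `Dφ(ψ y) u` is the velocity of the curve
`s ↦ φ(ψ y + s u)` in `S`. [cite: LeeSmoothManifolds2013, Prop. 3.23 and Prop. 5.38] -/
theorem mem_tangentVelocities_of_mem_range {y : Fin n → ℝ} (hy : y ∈ S ∩ c.U) {v : Fin n → ℝ}
    (hv : v ∈ range (fderiv ℝ c.φ (c.ψ y))) : v ∈ tangentVelocities S y := by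
  obtain ⟨u, rfl⟩ := hv
  have hball : c.ψ y ∈ ball (0 : Fin d → ℝ) 1 := c.ψ_mem_ball hy
  set γ : ℝ → Fin n → ℝ := fun s => c.φ (c.ψ y + s • u) with hγ
  have hline : HasDerivAt (fun s : ℝ => c.ψ y + s • u) u 0 := by
    have h := ((hasDerivAt_id (0 : ℝ)).smul_const u).const_add (c.ψ y)
    simpa using h
  have hcont : ContinuousAt (fun s : ℝ => c.ψ y + s • u) 0 := hline.continuousAt
  have hev : ∀ᶠ s in 𝓝 (0 : ℝ), c.ψ y + s • u ∈ ball (0 : Fin d → ℝ) 1 := by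
    refine hcont.preimage_mem_nhds (isOpen_ball.mem_nhds ?_)
    simpa using hball
  refine ⟨γ, hev.mono fun s hs => (c.φ_mem hs).1, by simp [hγ, c.φ_ψ hy], ?_⟩
  have h0 : c.ψ y + (0 : ℝ) • u = c.ψ y := by simp
  have hφ' : HasFDerivAt c.φ (fderiv ℝ c.φ (c.ψ y)) (c.ψ y + (0 : ℝ) • u) := by
    rw [h0]
    exact c.hasFDerivAt_φ hball
  exact hφ'.comp_hasDerivAt (0 : ℝ) hline

/-- **Tangent velocities are the image of `Dφ`** (`⊆`): a curve `γ` in `S` through `y` satisfies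
`γ = φ ∘ ψ ∘ γ` near `0`, so `γ′(0) = Dφ(ψ y)(Dψ(y) γ′(0))`.
[cite: LeeSmoothManifolds2013, Prop. 3.23 and Prop. 5.38] -/
theorem mem_range_of_mem_tangentVelocities {y : Fin n → ℝ} (hy : y ∈ S ∩ c.U) {v : Fin n → ℝ}
    (hv : v ∈ tangentVelocities S y) : v ∈ range (fderiv ℝ c.φ (c.ψ y)) := by
  obtain ⟨γ, hγS, hγ0, hγv⟩ := hv
  have hball : c.ψ y ∈ ball (0 : Fin d → ℝ) 1 := c.ψ_mem_ball hy
  have hγU : ∀ᶠ s in 𝓝 (0 : ℝ), γ s ∈ c.U := by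
    refine hγv.continuousAt.preimage_mem_nhds (c.isOpen_U.mem_nhds ?_)
    rw [hγ0]
    exact hy.2
  have heq : (fun s => c.φ (c.ψ (γ s))) =ᶠ[𝓝 0] γ := by
    filter_upwards [hγS, hγU] with s hsS hsU
    exact c.φ_ψ ⟨hsS, hsU⟩
  have hψ' : HasFDerivAt c.ψ (fderiv ℝ c.ψ y) (γ 0) := by
    rw [hγ0]
    exact c.hasFDerivAt_ψ hy.2
  have h1 : HasDerivAt (fun s => c.ψ (γ s)) (fderiv ℝ c.ψ y v) 0 := hψ'.comp_hasDerivAt (0 : ℝ) hγv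
  have hφ' : HasFDerivAt c.φ (fderiv ℝ c.φ (c.ψ y)) (c.ψ (γ 0)) := by
    rw [hγ0]
    exact c.hasFDerivAt_φ hball
  have h2 : HasDerivAt (fun s => c.φ (c.ψ (γ s))) (fderiv ℝ c.φ (c.ψ y) (fderiv ℝ c.ψ y v)) 0 :=
    hφ'.comp_hasDerivAt (0 : ℝ) h1
  have h3 : HasDerivAt γ (fderiv ℝ c.φ (c.ψ y) (fderiv ℝ c.ψ y v)) 0 :=
    h2.congr_of_eventuallyEq heq.symm
  exact ⟨fderiv ℝ c.ψ y v, (hγv.unique h3).symm⟩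

/-- **The tangent velocities of `S` at a chart point are the image of `Dφ(ψ y)`.**
[cite: LeeSmoothManifolds2013, Prop. 3.23 and Prop. 5.38] -/
theorem tangentVelocities_eq {y : Fin n → ℝ} (hy : y ∈ S ∩ c.U) :
    tangentVelocities S y = range (fderiv ℝ c.φ (c.ψ y)) :=
  Subset.antisymm (fun _ hv => c.mem_range_of_mem_tangentVelocities hy hv)
    (fun _ hv => c.mem_tangentVelocities_of_mem_range hy hv)

end SubmanifoldChart

/-! ### The secant cone (a first-order definable tangent cone) -/

/-- The **secant cone** of `S ⊆ ℝⁿ` at `x`: the directions `v` such that for every `ε > 0` there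
are `0 < t < ε` and `y ∈ S` with `|yᵢ - xᵢ - t vᵢ| ≤ ε t` for all `i` (i.e. `‖y - x - t v‖ ≤ ε t`
in the sup norm). A first-order condition on `(x, v)` over `S`; for `C¹` submanifolds it is the
tangent space (`secantCone_eq_tangentSpace`). [folklore] -/
def secantCone (S : Set (Fin n → ℝ)) (x : Fin n → ℝ) : Set (Fin n → ℝ) :=
  {v | ∀ ε : ℝ, 0 < ε → ∃ t : ℝ, 0 < t ∧ t < ε ∧ ∃ y ∈ S, ∀ i, |y i - x i - t * v i| ≤ ε * t}

/-- The coordinatewise condition of `secantCone` is the sup-norm condition `‖y - x - t • v‖ ≤ ε t`.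
[folklore] -/
theorem forall_abs_le_iff {x y v : Fin n → ℝ} {t r : ℝ} (hr : 0 ≤ r) :
    (∀ i, |y i - x i - t * v i| ≤ r) ↔ ‖y - x - t • v‖ ≤ r := by
  rw [pi_norm_le_iff_of_nonneg hr]
  refine forall_congr' fun i => ?_
  simp [Real.norm_eq_abs]

namespace SubmanifoldChart

variable {S : Set (Fin n → ℝ)} (c : SubmanifoldChart d S)

/-- **`range Dφ(ψ y) ⊆ secantCone S y`**: `φ(ψ y + t u) = y + t Dφ u + o(t)` lies in `S`.
[folklore] -/
theorem mem_secantCone_of_mem_range {y : Fin n → ℝ} (hy : y ∈ S ∩ c.U) {v : Fin n → ℝ}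
    (hv : v ∈ range (fderiv ℝ c.φ (c.ψ y))) : v ∈ secantCone S y := by
  obtain ⟨u, rfl⟩ := hv
  intro ε hε
  have hball : c.ψ y ∈ ball (0 : Fin d → ℝ) 1 := c.ψ_mem_ball hy
  set A := fderiv ℝ c.φ (c.ψ y) with hA
  -- little-o estimate of `φ` at `ψ y` with constant `ε / (‖u‖ + 1)`
  have hcpos : 0 < ε / (‖u‖ + 1) := div_pos hε (by positivity)
  have hlo := (hasFDerivAt_iff_isLittleO_nhds_zero.mp (c.hasFDerivAt_φ hball)).def hcpos
  -- pull back along `t ↦ t • u`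
  have hsm : Tendsto (fun t : ℝ => t • u) (𝓝 0) (𝓝 0) := by
    have h : Continuous fun t : ℝ => t • u := continuous_id.smul continuous_const
    simpa using h.tendsto 0
  have hballev : ∀ᶠ h in 𝓝 (0 : Fin d → ℝ), c.ψ y + h ∈ ball (0 : Fin d → ℝ) 1 := by
    have hc : Continuous fun h : Fin d → ℝ => c.ψ y + h := continuous_const.add continuous_id
    refine hc.continuousAt.preimage_mem_nhds (isOpen_ball.mem_nhds ?_)
    simpa using hball
  have hev : ∀ᶠ t in 𝓝 (0 : ℝ),
      ‖c.φ (c.ψ y + t • u) - c.φ (c.ψ y) - A (t • u)‖ ≤ ε / (‖u‖ + 1) * ‖t • u‖ ∧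
        c.ψ y + t • u ∈ ball (0 : Fin d → ℝ) 1 :=
    (hsm.eventually hlo).and (hsm.eventually hballev)
  have hev' : ∀ᶠ t in 𝓝[>] (0 : ℝ),
      (‖c.φ (c.ψ y + t • u) - c.φ (c.ψ y) - A (t • u)‖ ≤ ε / (‖u‖ + 1) * ‖t • u‖ ∧
        c.ψ y + t • u ∈ ball (0 : Fin d → ℝ) 1) ∧ (0 < t ∧ t < ε) := by
    refine (hev.filter_mono nhdsWithin_le_nhds).and ?_
    have h1 : ∀ᶠ t in 𝓝[>] (0 : ℝ), 0 < t := self_mem_nhdsWithin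
    have h2 : ∀ᶠ t in 𝓝[>] (0 : ℝ), t < ε :=
      (eventually_lt_nhds hε).filter_mono nhdsWithin_le_nhds
    exact h1.and h2
  obtain ⟨t, ⟨hest, htball⟩, ht0, htε⟩ := hev'.exists
  refine ⟨t, ht0, htε, c.φ (c.ψ y + t • u), (c.φ_mem htball).1, ?_⟩
  rw [forall_abs_le_iff (by positivity)]
  have hφψ : c.φ (c.ψ y) = y := c.φ_ψ hy
  calc ‖c.φ (c.ψ y + t • u) - y - t • A u‖
      = ‖c.φ (c.ψ y + t • u) - c.φ (c.ψ y) - A (t • u)‖ := by rw [hφψ, map_smul]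
    _ ≤ ε / (‖u‖ + 1) * ‖t • u‖ := hest
    _ = ε * t * (‖u‖ / (‖u‖ + 1)) := by
        rw [norm_smul, Real.norm_eq_abs, abs_of_pos ht0]
        ring
    _ ≤ ε * t * 1 := by
        refine mul_le_mul_of_nonneg_left ?_ (by positivity)
        rw [div_le_one (by positivity)]
        linarith [norm_nonneg u]
    _ = ε * t := mul_one _

/-- **`secantCone S y ⊆ range Dφ(ψ y)`**: with `Q = 1 - Dφ(ψ y) Dψ(y)`, `Q` vanishes on tangent
vectors, and `Q(y' - y) = o(‖y' - y‖)` for `y' ∈ S` near `y` (since `φ ∘ ψ = id` on `S ∩ U`);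
a secant direction `v` therefore has `Q v = 0`, i.e. `v = Dφ(Dψ v)`. [folklore] -/
theorem mem_range_of_mem_secantCone {y : Fin n → ℝ} (hy : y ∈ S ∩ c.U) {v : Fin n → ℝ}
    (hv : v ∈ secantCone S y) : v ∈ range (fderiv ℝ c.φ (c.ψ y)) := by
  have hball : c.ψ y ∈ ball (0 : Fin d → ℝ) 1 := c.ψ_mem_ball hy
  set A := fderiv ℝ c.φ (c.ψ y) with hA
  set B := fderiv ℝ c.ψ y with hB
  set Q : (Fin n → ℝ) →L[ℝ] (Fin n → ℝ) := ContinuousLinearMap.id ℝ _ - A.comp B with hQ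
  -- it suffices that `Q v = 0`
  suffices hQv : Q v = 0 by
    refine ⟨B v, ?_⟩
    have : v - A (B v) = 0 := by simpa [hQ] using hQv
    exact (sub_eq_zero.mp this).symm
  by_contra hne
  set η : ℝ := ‖Q v‖ with hη
  have hηpos : 0 < η := norm_pos_iff.mpr hne
  -- `Φ = φ ∘ ψ` is differentiable at `y` with derivative `A ∘ B`, and `Φ = id` on `S ∩ U`
  have hΦ : HasFDerivAt (fun z => c.φ (c.ψ z)) (A.comp B) y := by
    have hφ' : HasFDerivAt c.φ A (c.ψ y) := c.hasFDerivAt_φ hball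
    exact hφ'.comp y (c.hasFDerivAt_ψ hy.2)
  have hc₁pos : 0 < η / (4 * (‖v‖ + 1)) := div_pos hηpos (by positivity)
  have hlo := (hasFDerivAt_iff_isLittleO_nhds_zero.mp hΦ).def hc₁pos
  have hUev : ∀ᶠ h in 𝓝 (0 : Fin n → ℝ), y + h ∈ c.U := by
    have hc : Continuous fun h : Fin n → ℝ => y + h := continuous_const.add continuous_id
    refine hc.continuousAt.preimage_mem_nhds (c.isOpen_U.mem_nhds ?_)
    simpa using hy.2
  obtain ⟨δ, hδpos, hδ⟩ := Metric.eventually_nhds_iff.mp (hlo.and hUev)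
  -- choose `ε`
  obtain ⟨ε, hεpos, hε1, hεδ, hεQ⟩ : ∃ ε : ℝ, 0 < ε ∧ ε ≤ 1 ∧ ε * (‖v‖ + 1) < δ ∧
      ‖Q‖ * ε ≤ η / 4 := by
    refine ⟨min (min 1 (δ / (2 * (‖v‖ + 1)))) (η / (4 * (‖Q‖ + 1))), ?_, ?_, ?_, ?_⟩
    · positivity
    · exact (min_le_left _ _).trans (min_le_left _ _)
    · have h1 : min (min 1 (δ / (2 * (‖v‖ + 1)))) (η / (4 * (‖Q‖ + 1))) ≤
          δ / (2 * (‖v‖ + 1)) := (min_le_left _ _).trans (min_le_right _ _)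
      have hvpos : 0 < ‖v‖ + 1 := by positivity
      calc min (min 1 (δ / (2 * (‖v‖ + 1)))) (η / (4 * (‖Q‖ + 1))) * (‖v‖ + 1)
          ≤ δ / (2 * (‖v‖ + 1)) * (‖v‖ + 1) := mul_le_mul_of_nonneg_right h1 hvpos.le
        _ = δ / 2 := by field_simp
        _ < δ := by linarith
    · have h1 : min (min 1 (δ / (2 * (‖v‖ + 1)))) (η / (4 * (‖Q‖ + 1))) ≤
          η / (4 * (‖Q‖ + 1)) := min_le_right _ _
      have hQpos : 0 < ‖Q‖ + 1 := by positivity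
      calc ‖Q‖ * min (min 1 (δ / (2 * (‖v‖ + 1)))) (η / (4 * (‖Q‖ + 1)))
          ≤ (‖Q‖ + 1) * (η / (4 * (‖Q‖ + 1))) :=
            mul_le_mul (by linarith) h1 (by positivity) hQpos.le
        _ = η / 4 := by field_simp
  -- a secant point at scale `t < ε`
  obtain ⟨t, ht0, htε, y', hy'S, hy'⟩ := hv ε hεpos
  rw [forall_abs_le_iff (by positivity)] at hy'
  set h : Fin n → ℝ := y' - y with hh
  have hh_tv : ‖h - t • v‖ ≤ ε * t := hy'
  have hh_norm : ‖h‖ ≤ t * (‖v‖ + 1) := by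
    calc ‖h‖ = ‖(h - t • v) + t • v‖ := by rw [sub_add_cancel]
      _ ≤ ‖h - t • v‖ + ‖t • v‖ := norm_add_le _ _
      _ ≤ ε * t + t * ‖v‖ := by
          rw [norm_smul, Real.norm_eq_abs, abs_of_pos ht0]
          exact add_le_add hh_tv le_rfl
      _ ≤ 1 * t + t * ‖v‖ := by nlinarith
      _ = t * (‖v‖ + 1) := by ring
  have hh_lt : ‖h‖ < δ := by
    calc ‖h‖ ≤ t * (‖v‖ + 1) := hh_norm
      _ < ε * (‖v‖ + 1) := by
          exact mul_lt_mul_of_pos_right htε (by positivity)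
      _ < δ := hεδ
  have hdist : dist h 0 < δ := by simpa using hh_lt
  obtain ⟨hest, hyU⟩ := hδ hdist
  -- `Φ(y + h) = y + h` and `Φ y = y`
  have hy'U : y' ∈ S ∩ c.U := ⟨hy'S, by simpa [hh] using hyU⟩
  have hΦy' : c.φ (c.ψ (y + h)) = y + h := by
    have : y + h = y' := by simp [hh]
    rw [this]
    exact c.φ_ψ hy'U
  have hΦy : c.φ (c.ψ y) = y := c.φ_ψ hy
  have hQh : ‖Q h‖ ≤ η / (4 * (‖v‖ + 1)) * ‖h‖ := by
    have e : c.φ (c.ψ (y + h)) - c.φ (c.ψ y) - (A.comp B) h = Q h := by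
      rw [hΦy', hΦy]
      simp [hQ]
    rw [← e]
    exact hest
  -- `Q h = t • Q v + Q (h - t • v)`
  have hsplit : t • Q v = Q h - Q (h - t • v) := by
    simp only [map_sub, map_smul, sub_sub_cancel]
  have key : t * η ≤ t * η / 2 := by
    calc t * η = ‖t • Q v‖ := by rw [norm_smul, Real.norm_eq_abs, abs_of_pos ht0]
      _ = ‖Q h - Q (h - t • v)‖ := by rw [hsplit]
      _ ≤ ‖Q h‖ + ‖Q (h - t • v)‖ := norm_sub_le _ _
      _ ≤ η / (4 * (‖v‖ + 1)) * ‖h‖ + ‖Q‖ * ‖h - t • v‖ :=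
          add_le_add hQh (Q.le_opNorm _)
      _ ≤ η / (4 * (‖v‖ + 1)) * (t * (‖v‖ + 1)) + ‖Q‖ * (ε * t) :=
          add_le_add (mul_le_mul_of_nonneg_left hh_norm hc₁pos.le)
            (mul_le_mul_of_nonneg_left hh_tv (norm_nonneg _))
      _ = t * (η / 4) + t * (‖Q‖ * ε) := by
          have hvpos : (‖v‖ + 1) ≠ 0 := by positivity
          field_simp
      _ ≤ t * (η / 4) + t * (η / 4) :=
          add_le_add le_rfl (mul_le_mul_of_nonneg_left hεQ ht0.le)
      _ = t * η / 2 := by ring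
  have : t * η ≤ 0 := by linarith
  exact absurd this (not_le.mpr (mul_pos ht0 hηpos))

/-- **The secant cone at a chart point is the image of `Dφ(ψ y)`.** [folklore] -/
theorem secantCone_eq {y : Fin n → ℝ} (hy : y ∈ S ∩ c.U) :
    secantCone S y = range (fderiv ℝ c.φ (c.ψ y)) :=
  Subset.antisymm (fun _ hv => c.mem_range_of_mem_secantCone hy hv)
    (fun _ hv => c.mem_secantCone_of_mem_range hy hv)

end SubmanifoldChart

/-! ### The tangent space -/

/-- **The tangent space** `T_x S ⊆ ℝⁿ` of a subset `S ⊆ ℝⁿ` at `x`: the linear span of the kinematic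
tangent vectors `tangentVelocities S x`. For a point of a `C^∞` submanifold of dimension `d` it is
`d`-dimensional and *equals* `tangentVelocities S x` and `secantCone S x`
(`coe_tangentSpace`, `secantCone_eq_tangentSpace`, `finrank_tangentSpace`).
[cite: LeeSmoothManifolds2013, Prop. 3.23 and Prop. 5.38] -/
def tangentSpace (S : Set (Fin n → ℝ)) (x : Fin n → ℝ) : Submodule ℝ (Fin n → ℝ) :=
  Submodule.span ℝ (tangentVelocities S x)

namespace SubmanifoldChart

variable {S : Set (Fin n → ℝ)} (c : SubmanifoldChart d S)

/-- In a chart, the tangent space is the range of `Dφ(ψ y)`. [folklore] -/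
theorem tangentSpace_eq {y : Fin n → ℝ} (hy : y ∈ S ∩ c.U) :
    tangentSpace S y =
      LinearMap.range ((fderiv ℝ c.φ (c.ψ y) : (Fin d → ℝ) →L[ℝ] (Fin n → ℝ)) :
        (Fin d → ℝ) →ₗ[ℝ] (Fin n → ℝ)) := by
  rw [tangentSpace, c.tangentVelocities_eq hy]
  refine le_antisymm (Submodule.span_le.mpr ?_) ?_
  · rintro _ ⟨u, rfl⟩
    exact ⟨u, rfl⟩
  · rintro _ ⟨u, rfl⟩
    exact Submodule.subset_span ⟨u, rfl⟩

/-- In a chart, the tangent space as a set is the range of `Dφ(ψ y)`. [folklore] -/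
theorem coe_tangentSpace_eq {y : Fin n → ℝ} (hy : y ∈ S ∩ c.U) :
    (tangentSpace S y : Set (Fin n → ℝ)) = range (fderiv ℝ c.φ (c.ψ y)) := by
  rw [c.tangentSpace_eq hy]
  rfl

end SubmanifoldChart

section TangentSpace

variable {S : Set (Fin n → ℝ)} (hS : IsSubmanifoldOfDim d S) {x : Fin n → ℝ} (hx : x ∈ S)
include hS hx

/-- **At a point of a `C^∞` submanifold, the tangent space is the set of tangent velocities**
(the kinematic tangent vectors already form a linear subspace).
[cite: LeeSmoothManifolds2013, Prop. 3.23 and Prop. 5.38] -/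
theorem coe_tangentSpace : (tangentSpace S x : Set (Fin n → ℝ)) = tangentVelocities S x := by
  obtain ⟨c, hxU⟩ := hS.exists_chart hx
  rw [c.coe_tangentSpace_eq ⟨hx, hxU⟩, c.tangentVelocities_eq ⟨hx, hxU⟩]

/-- Membership form of `coe_tangentSpace`. [folklore] -/
theorem mem_tangentSpace_iff {v : Fin n → ℝ} : v ∈ tangentSpace S x ↔ v ∈ tangentVelocities S x := by
  rw [← SetLike.mem_coe, coe_tangentSpace hS hx]

/-- **At a point of a `C^∞` submanifold, the secant cone is the tangent space.** [folklore] -/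
theorem secantCone_eq_tangentSpace : secantCone S x = (tangentSpace S x : Set (Fin n → ℝ)) := by
  obtain ⟨c, hxU⟩ := hS.exists_chart hx
  rw [c.coe_tangentSpace_eq ⟨hx, hxU⟩, c.secantCone_eq ⟨hx, hxU⟩]

/-- **The tangent space of a `d`-dimensional submanifold is `d`-dimensional.**
[cite: LeeSmoothManifolds2013, Prop. 3.10 / Prop. 5.38] -/
theorem finrank_tangentSpace : Module.finrank ℝ (tangentSpace S x) = d := by
  obtain ⟨c, hxU⟩ := hS.exists_chart hx
  rw [c.tangentSpace_eq ⟨hx, hxU⟩,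
    LinearMap.finrank_range_of_inj (c.injective_fderiv_φ (c.ψ_mem_ball ⟨hx, hxU⟩)),
    Module.finrank_fin_fun]

end TangentSpace

/-! ### The orthogonal projection onto a subspace of `ℝⁿ` (dot product) -/

section OrthProj

variable (K : Submodule ℝ (Fin n → ℝ))

/-- The subspace `K ⊆ ℝⁿ` read in `EuclideanSpace ℝ (Fin n)`. [folklore] -/
def euclideanOf : Submodule ℝ (EuclideanSpace ℝ (Fin n)) :=
  K.comap ((EuclideanSpace.equiv (Fin n) ℝ : EuclideanSpace ℝ (Fin n) ≃L[ℝ] (Fin n → ℝ)) :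
    EuclideanSpace ℝ (Fin n) →ₗ[ℝ] (Fin n → ℝ))

/-- Membership in `euclideanOf K`. [folklore] -/
theorem mem_euclideanOf_iff (v : EuclideanSpace ℝ (Fin n)) :
    v ∈ euclideanOf K ↔ EuclideanSpace.equiv (Fin n) ℝ v ∈ K :=
  Iff.rfl

/-- **The orthogonal projection `ℝⁿ → ℝⁿ` onto the subspace `K`** for the dot product
`v ⬝ᵥ w = Σ vᵢ wᵢ`: Mathlib's `Submodule.starProjection` of `K` read in `EuclideanSpace ℝ (Fin n)`,
transported back along `EuclideanSpace.equiv`. [folklore] -/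
def orthProj : (Fin n → ℝ) →L[ℝ] (Fin n → ℝ) :=
  ((EuclideanSpace.equiv (Fin n) ℝ : EuclideanSpace ℝ (Fin n) ≃L[ℝ] (Fin n → ℝ)) :
      EuclideanSpace ℝ (Fin n) →L[ℝ] (Fin n → ℝ)).comp
    ((euclideanOf K).starProjection.comp
      ((EuclideanSpace.equiv (Fin n) ℝ).symm : (Fin n → ℝ) →L[ℝ] EuclideanSpace ℝ (Fin n)))

/-- Unfolding of `orthProj`. [folklore] -/
theorem orthProj_apply (v : Fin n → ℝ) :
    orthProj K v = EuclideanSpace.equiv (Fin n) ℝ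
      ((euclideanOf K).starProjection ((EuclideanSpace.equiv (Fin n) ℝ).symm v)) :=
  rfl

/-- The inner product of `EuclideanSpace ℝ (Fin n)` is the dot product of the coordinate vectors.
[folklore] -/
theorem inner_eq_dotProduct (a b : EuclideanSpace ℝ (Fin n)) :
    inner ℝ a b = EuclideanSpace.equiv (Fin n) ℝ a ⬝ᵥ EuclideanSpace.equiv (Fin n) ℝ b := by
  rw [EuclideanSpace.inner_eq_star_dotProduct, star_trivial, dotProduct_comm]
  rfl

/-- `orthProj K v ∈ K`. [folklore] -/
theorem orthProj_mem (v : Fin n → ℝ) : orthProj K v ∈ K :=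
  (mem_euclideanOf_iff K _).mp ((euclideanOf K).starProjection_apply_mem _)

/-- `v - orthProj K v` is orthogonal to `K`. [folklore] -/
theorem dotProduct_sub_orthProj_eq_zero (v : Fin n → ℝ) {w : Fin n → ℝ} (hw : w ∈ K) :
    (v - orthProj K v) ⬝ᵥ w = 0 := by
  set e := EuclideanSpace.equiv (Fin n) ℝ with he
  have hw' : e.symm w ∈ euclideanOf K := by
    rw [mem_euclideanOf_iff, ← he, e.apply_symm_apply]
    exact hw
  have h := (euclideanOf K).starProjection_inner_eq_zero (e.symm v) (e.symm w) hw'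
  rw [inner_eq_dotProduct, ← he, map_sub, e.apply_symm_apply, e.apply_symm_apply] at h
  rw [orthProj_apply, ← he]
  exact h

/-- **Characterisation of the orthogonal projection**: the point `u ∈ K` with `v - u ⊥ K` is
`orthProj K v`. [folklore] -/
theorem orthProj_eq_of_mem_of_dotProduct_eq_zero {v u : Fin n → ℝ} (hu : u ∈ K)
    (horth : ∀ w ∈ K, (v - u) ⬝ᵥ w = 0) : orthProj K v = u := by
  set e := EuclideanSpace.equiv (Fin n) ℝ with he
  have hu' : e.symm u ∈ euclideanOf K := by
    rw [mem_euclideanOf_iff, ← he, e.apply_symm_apply]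
    exact hu
  have hvo : ∀ w ∈ euclideanOf K, inner ℝ (e.symm v - e.symm u) w = 0 := by
    intro w hw
    rw [inner_eq_dotProduct, ← he, map_sub, e.apply_symm_apply, e.apply_symm_apply]
    have hw' : e w ∈ K := hw
    exact horth _ hw'
  have h := (euclideanOf K).eq_starProjection_of_mem_of_inner_eq_zero hu' hvo
  rw [orthProj_apply, ← he, h, e.apply_symm_apply]

/-- The orthogonal projection fixes `K`. [folklore] -/
theorem orthProj_eq_self {v : Fin n → ℝ} (hv : v ∈ K) : orthProj K v = v :=
  orthProj_eq_of_mem_of_dotProduct_eq_zero K hv fun w _ => by simp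

/-- The orthogonal projection is idempotent. [folklore] -/
theorem orthProj_orthProj (v : Fin n → ℝ) : orthProj K (orthProj K v) = orthProj K v :=
  orthProj_eq_self K (orthProj_mem K v)

/-- The range of the orthogonal projection is `K`. [folklore] -/
theorem range_orthProj : range (orthProj K) = K :=
  Subset.antisymm (by rintro _ ⟨v, rfl⟩; exact orthProj_mem K v)
    fun v hv => ⟨v, orthProj_eq_self K hv⟩

/-- The orthogonal projection is self-adjoint for the dot product. [folklore] -/
theorem dotProduct_orthProj_comm (v w : Fin n → ℝ) :
    orthProj K v ⬝ᵥ w = v ⬝ᵥ orthProj K w := by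
  have h1 : (v - orthProj K v) ⬝ᵥ orthProj K w = 0 :=
    dotProduct_sub_orthProj_eq_zero K v (orthProj_mem K w)
  have h2 : (w - orthProj K w) ⬝ᵥ orthProj K v = 0 :=
    dotProduct_sub_orthProj_eq_zero K w (orthProj_mem K v)
  rw [sub_dotProduct, sub_eq_zero] at h1 h2
  rw [h1, dotProduct_comm (orthProj K v) w, h2, dotProduct_comm]

end OrthProj


/-! ### Smoothness of matrix inversion (Cramer's rule) -/

section MatrixCalculus

variable {E : Type*} [NormedAddCommGroup E] [NormedSpace ℝ E] {m : Type*} [Fintype m]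
  [DecidableEq m] {s : Set E}

/-- The determinant of a matrix of `C^∞` functions is `C^∞`. [folklore] -/
theorem contDiffOn_matrix_det {M : E → Matrix m m ℝ}
    (hM : ∀ i j, ContDiffOn ℝ ∞ (fun y => M y i j) s) :
    ContDiffOn ℝ ∞ (fun y => (M y).det) s := by
  have h : (fun y => (M y).det) =
      fun y => ∑ σ : Equiv.Perm m, ((Equiv.Perm.sign σ : ℤ) : ℝ) * ∏ i, M y (σ i) i := by
    funext y
    rw [Matrix.det_apply']
  rw [h]
  exact ContDiffOn.sum fun σ _ => contDiffOn_const.mul (contDiffOn_prod fun i _ => hM (σ i) i)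

/-- The adjugate of a matrix of `C^∞` functions has `C^∞` entries. [folklore] -/
theorem contDiffOn_matrix_adjugate {M : E → Matrix m m ℝ}
    (hM : ∀ i j, ContDiffOn ℝ ∞ (fun y => M y i j) s) (i j : m) :
    ContDiffOn ℝ ∞ (fun y => (M y).adjugate i j) s := by
  simp only [Matrix.adjugate_apply]
  refine contDiffOn_matrix_det fun i' j' => ?_
  simp only [Matrix.updateRow_apply]
  by_cases h : i' = j
  · simp only [h, if_true]
    exact contDiffOn_const
  · simp only [h, if_false]
    exact hM i' j'

/-- **Cramer's rule is smooth**: where the determinant does not vanish, the inverse of a matrix of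
`C^∞` functions has `C^∞` entries. [folklore] -/
theorem contDiffOn_matrix_inv {M : E → Matrix m m ℝ}
    (hM : ∀ i j, ContDiffOn ℝ ∞ (fun y => M y i j) s) (hdet : ∀ y ∈ s, (M y).det ≠ 0) (i j : m) :
    ContDiffOn ℝ ∞ (fun y => (M y)⁻¹ i j) s := by
  have h : (fun y => (M y)⁻¹ i j) = fun y => ((M y).det)⁻¹ * (M y).adjugate i j := by
    funext y
    rw [Matrix.inv_def, Ring.inverse_eq_inv, Matrix.smul_apply, smul_eq_mul]
  rw [h]
  exact ((contDiffOn_matrix_det hM).inv hdet).mul (contDiffOn_matrix_adjugate hM i j)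

omit [DecidableEq m] in
/-- Entries of a product of matrices of `C^∞` functions are `C^∞`. [folklore] -/
theorem contDiffOn_matrix_mul {l p : Type*} [Fintype l] [Fintype p] {M : E → Matrix l m ℝ}
    {N : E → Matrix m p ℝ} (hM : ∀ i j, ContDiffOn ℝ ∞ (fun y => M y i j) s)
    (hN : ∀ i j, ContDiffOn ℝ ∞ (fun y => N y i j) s) (i : l) (j : p) :
    ContDiffOn ℝ ∞ (fun y => (M y * N y) i j) s := by
  simp only [Matrix.mul_apply]
  exact ContDiffOn.sum fun r _ => (hM i r).mul (hN r j)

/-- The linear map of a matrix of `C^∞` functions is a `C^∞` field of continuous linear maps.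
[folklore] -/
theorem contDiffOn_matrix_toLin {l : Type*} [Fintype l] [DecidableEq l] {M : E → Matrix l m ℝ}
    (hM : ∀ i j, ContDiffOn ℝ ∞ (fun y => M y i j) s) :
    ContDiffOn ℝ ∞ (fun y => LinearMap.toContinuousLinearMap (Matrix.toLin' (M y))) s := by
  refine contDiffOn_clm_apply.mpr fun v => ?_
  refine contDiffOn_pi.mpr fun i => ?_
  have h : (fun y => (LinearMap.toContinuousLinearMap (Matrix.toLin' (M y))) v i) =
      fun y => ∑ j, M y i j * v j := by
    funext y
    simp [Matrix.toLin'_apply, Matrix.mulVec, dotProduct]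
  rw [h]
  exact ContDiffOn.sum fun j _ => (hM i j).mul contDiffOn_const

end MatrixCalculus

/-! ### The tangent projection in a chart: `B (BᵀB)⁻¹ Bᵀ`, `B = Dφ ∘ ψ` -/

namespace SubmanifoldChart

variable {S : Set (Fin n → ℝ)} (c : SubmanifoldChart d S)

/-- The reduced chart domain `U' = U ∩ ψ⁻¹(B)` (open, contains `S ∩ U`). [folklore] -/
def U' : Set (Fin n → ℝ) := c.U ∩ c.ψ ⁻¹' ball 0 1

/-- `U'` is open. [folklore] -/
theorem isOpen_U' : IsOpen c.U' :=
  c.contDiffOn_ψ.continuousOn.isOpen_inter_preimage c.isOpen_U isOpen_ball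

/-- `S ∩ U ⊆ U'`. [folklore] -/
theorem subset_U' : S ∩ c.U ⊆ c.U' := fun _ hy => ⟨hy.2, c.ψ_mem_ball hy⟩

/-- `U' ⊆ U`. [folklore] -/
theorem U'_subset : c.U' ⊆ c.U := inter_subset_left

/-- The Jacobian field `B(y) = Dφ(ψ y)` on `ℝⁿ`. [folklore] -/
def jac (y : Fin n → ℝ) : (Fin d → ℝ) →L[ℝ] (Fin n → ℝ) := fderiv ℝ c.φ (c.ψ y)

/-- `B` is `C^∞` on `U'`. [folklore] -/
theorem contDiffOn_jac : ContDiffOn ℝ ∞ c.jac c.U' := by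
  have h1 : ContDiffOn ℝ ∞ (fderiv ℝ c.φ) (ball 0 1) :=
    c.contDiffOn_φ.fderiv_of_isOpen isOpen_ball le_rfl
  exact h1.comp (c.contDiffOn_ψ.mono c.U'_subset) fun y hy => hy.2

/-- The Jacobian matrix `M(y)` of `B(y)` (an `n × d` matrix). [folklore] -/
def jacMat (y : Fin n → ℝ) : Matrix (Fin n) (Fin d) ℝ :=
  LinearMap.toMatrix' (c.jac y : (Fin d → ℝ) →ₗ[ℝ] (Fin n → ℝ))

/-- Entries of the Jacobian matrix. [folklore] -/
theorem jacMat_apply (y : Fin n → ℝ) (i : Fin n) (l : Fin d) :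
    c.jacMat y i l = c.jac y (Pi.single l 1) i :=
  LinearMap.toMatrix'_apply _ i l

/-- `M(y) u = B(y) u`. [folklore] -/
theorem jacMat_mulVec (y : Fin n → ℝ) (u : Fin d → ℝ) : c.jacMat y *ᵥ u = c.jac y u := by
  rw [← Matrix.toLin'_apply, jacMat, Matrix.toLin'_toMatrix']
  rfl

/-- The entries of `M` are `C^∞` on `U'`. [folklore] -/
theorem contDiffOn_jacMat (i : Fin n) (l : Fin d) :
    ContDiffOn ℝ ∞ (fun y => c.jacMat y i l) c.U' := by
  simp only [jacMat_apply]
  have h : ContDiffOn ℝ ∞ (fun y => c.jac y (Pi.single l 1)) c.U' :=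
    c.contDiffOn_jac.clm_apply contDiffOn_const
  exact contDiffOn_pi.mp h i

/-- The Gram matrix `G(y) = M(y)ᵀ M(y)` (`d × d`). [folklore] -/
def gram (y : Fin n → ℝ) : Matrix (Fin d) (Fin d) ℝ := (c.jacMat y)ᵀ * c.jacMat y

/-- The entries of `G` are `C^∞` on `U'`. [folklore] -/
theorem contDiffOn_gram (l l' : Fin d) : ContDiffOn ℝ ∞ (fun y => c.gram y l l') c.U' :=
  contDiffOn_matrix_mul (fun i j => by simpa using c.contDiffOn_jacMat j i)
    (fun i j => c.contDiffOn_jacMat i j) l l'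

/-- **The Gram matrix is invertible at points of `S ∩ U`** (`B(y)` is injective there).
[folklore] -/
theorem det_gram_ne_zero {y : Fin n → ℝ} (hy : y ∈ S ∩ c.U) : (c.gram y).det ≠ 0 := by
  intro hdet
  obtain ⟨u, hu, hGu⟩ := Matrix.exists_mulVec_eq_zero_iff.mpr hdet
  have h1 : (c.jacMat y *ᵥ u) ⬝ᵥ (c.jacMat y *ᵥ u) = 0 := by
    have h := congrArg (fun w => u ⬝ᵥ w) hGu
    simp only [dotProduct_zero] at h
    rwa [gram, ← Matrix.mulVec_mulVec, Matrix.dotProduct_mulVec, Matrix.vecMul_transpose] at h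
  have h2 : c.jacMat y *ᵥ u = 0 := dotProduct_self_eq_zero.mp h1
  rw [c.jacMat_mulVec] at h2
  exact hu (c.injective_fderiv_φ (c.ψ_mem_ball hy) (by rw [jac] at h2; rw [h2, map_zero]))

/-- The domain `U'' = {y ∈ U' | det G(y) ≠ 0}` of the local projection formula (open, contains
`S ∩ U`). [folklore] -/
def U'' : Set (Fin n → ℝ) := c.U' ∩ (fun y => (c.gram y).det) ⁻¹' {0}ᶜ

/-- `U''` is open. [folklore] -/
theorem isOpen_U'' : IsOpen c.U'' :=
  (contDiffOn_matrix_det c.contDiffOn_gram).continuousOn.isOpen_inter_preimage c.isOpen_U'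
    isOpen_compl_singleton

/-- `S ∩ U ⊆ U''`. [folklore] -/
theorem subset_U'' : S ∩ c.U ⊆ c.U'' := fun _ hy => ⟨c.subset_U' hy, c.det_gram_ne_zero hy⟩

/-- The projection matrix `P(y) = M G⁻¹ Mᵀ` (`n × n`). [folklore] -/
def projMat (y : Fin n → ℝ) : Matrix (Fin n) (Fin n) ℝ :=
  c.jacMat y * (c.gram y)⁻¹ * (c.jacMat y)ᵀ

/-- The entries of `P` are `C^∞` on `U''`. [folklore] -/
theorem contDiffOn_projMat (i j : Fin n) : ContDiffOn ℝ ∞ (fun y => c.projMat y i j) c.U'' := by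
  have hM : ∀ i l, ContDiffOn ℝ ∞ (fun y => c.jacMat y i l) c.U'' :=
    fun i l => (c.contDiffOn_jacMat i l).mono inter_subset_left
  have hG : ∀ l l', ContDiffOn ℝ ∞ (fun y => (c.gram y)⁻¹ l l') c.U'' :=
    contDiffOn_matrix_inv (fun l l' => (c.contDiffOn_gram l l').mono inter_subset_left)
      fun y hy => hy.2
  exact contDiffOn_matrix_mul (contDiffOn_matrix_mul hM hG) (fun l j => by simpa using hM j l) i j

/-- The local projection field `P(y) : ℝⁿ → ℝⁿ` as continuous linear maps. [folklore] -/
def projCLM (y : Fin n → ℝ) : (Fin n → ℝ) →L[ℝ] (Fin n → ℝ) :=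
  LinearMap.toContinuousLinearMap (Matrix.toLin' (c.projMat y))

/-- `P(y) v = (M G⁻¹ Mᵀ) v`. [folklore] -/
theorem projCLM_apply (y v : Fin n → ℝ) : c.projCLM y v = c.projMat y *ᵥ v := by
  simp [projCLM, Matrix.toLin'_apply]

/-- The local projection field is `C^∞` on `U''`. [folklore] -/
theorem contDiffOn_projCLM : ContDiffOn ℝ ∞ c.projCLM c.U'' :=
  contDiffOn_matrix_toLin c.contDiffOn_projMat

/-- `Mᵀ P = Mᵀ`: `Mᵀ (M G⁻¹ Mᵀ v) = Mᵀ v` when `G = MᵀM` is invertible. [folklore] -/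
theorem transpose_mulVec_projMat_mulVec {y : Fin n → ℝ} (hdet : (c.gram y).det ≠ 0)
    (v : Fin n → ℝ) : (c.jacMat y)ᵀ *ᵥ (c.projMat y *ᵥ v) = (c.jacMat y)ᵀ *ᵥ v := by
  have hunit : IsUnit (c.gram y).det := isUnit_iff_ne_zero.mpr hdet
  rw [Matrix.mulVec_mulVec, projMat, ← Matrix.mul_assoc, ← Matrix.mul_assoc,
    show (c.jacMat y)ᵀ * c.jacMat y = c.gram y from rfl, Matrix.mul_nonsing_inv _ hunit,
    Matrix.one_mul]

/-- **At points of `S ∩ U` the local field is the orthogonal projection onto the tangent space.**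
[folklore] -/
theorem projCLM_eq_orthProj {y : Fin n → ℝ} (hy : y ∈ S ∩ c.U) :
    c.projCLM y = orthProj (tangentSpace S y) := by
  ext1 v
  symm
  refine orthProj_eq_of_mem_of_dotProduct_eq_zero _ ?_ fun w hw => ?_
  · -- `P v ∈ T_y S = range B`
    rw [← SetLike.mem_coe, c.coe_tangentSpace_eq hy, c.projCLM_apply, projMat, Matrix.mul_assoc,
      ← Matrix.mulVec_mulVec, c.jacMat_mulVec]
    exact ⟨_, rfl⟩
  · -- `v - P v ⊥ range B`
    rw [← SetLike.mem_coe, c.coe_tangentSpace_eq hy] at hw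
    obtain ⟨u, rfl⟩ := hw
    change (v - c.projCLM y v) ⬝ᵥ c.jac y u = 0
    rw [← c.jacMat_mulVec, Matrix.dotProduct_mulVec, ← Matrix.mulVec_transpose, Matrix.mulVec_sub,
      c.projCLM_apply, c.transpose_mulVec_projMat_mulVec (c.det_gram_ne_zero hy), sub_self,
      zero_dotProduct]

/-- **Local smooth representative of the tangent projection**: near a point of `S`, the field
`y ↦ orthProj (T_y S)` on `S` is the restriction of a `C^∞` field of projections
(`B (BᵀB)⁻¹ Bᵀ` with `B = Dφ ∘ ψ`). [cite: LeeSmoothManifolds2013, Prop. 5.16 ff.] -/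
theorem exists_local_orthProj {x : Fin n → ℝ} (hx : x ∈ S ∩ c.U) :
    ∃ O ∈ 𝓝 x, ∃ P : (Fin n → ℝ) → ((Fin n → ℝ) →L[ℝ] (Fin n → ℝ)),
      ContDiffOn ℝ ∞ P O ∧ ∀ y ∈ S ∩ O, P y = orthProj (tangentSpace S y) :=
  ⟨c.U'', c.isOpen_U''.mem_nhds (c.subset_U'' hx), c.projCLM, c.contDiffOn_projCLM,
    fun _ hy => c.projCLM_eq_orthProj ⟨hy.1, c.U'_subset hy.2.1⟩⟩

end SubmanifoldChart

/-- **The tangent projection field of a closed `C^∞` submanifold is smooth**: there is a `C^∞` map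
`P : ℝⁿ → L(ℝⁿ, ℝⁿ)` with `P(x) =` the orthogonal projection onto `T_x S` for every `x ∈ S`
(local formula `B(BᵀB)⁻¹Bᵀ` glued by a partition of unity along the closed set `S`).
[cite: LeeSmoothManifolds2013, Lemma 2.26 and Prop. 5.16 ff.] -/
theorem IsSubmanifoldOfDim.exists_contDiff_orthProj {S : Set (Fin n → ℝ)}
    (hS : IsSubmanifoldOfDim d S) (hSc : IsClosed S) :
    ∃ P : (Fin n → ℝ) → ((Fin n → ℝ) →L[ℝ] (Fin n → ℝ)), ContDiff ℝ ∞ P ∧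
      ∀ x ∈ S, P x = orthProj (tangentSpace S x) := by
  refine exists_contDiff_of_local hSc (fun x => orthProj (tangentSpace S x)) fun x hx => ?_
  obtain ⟨c, hxU⟩ := hS.exists_chart hx
  exact c.exists_local_orthProj ⟨hx, hxU⟩

end Literature.AlgebraicGeometry.RealAlgebraic

end
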